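import Literature.AlgebraicGeometry.HodgeTheory.BettiKunnethPieceCorrespondenceRepresentationRank
import Literature.AlgebraicGeometry.HodgeTheory.BettiHodgeConjectureProductNoExceptionalClasses
import Literature.AlgebraicGeometry.HodgeTheory.BettiIrregularityHodgeTateType
import HarnessLib

/-!
# `HC(T × Z)` for a smooth projective threefold with `q(T) = 0`, `h^{2,0}(T) = 0` (Calabi–Yau, Fano threefolds, …) times an `n`-fold with `HC(Z)` iff the morphisms of Hodge structures
# `H³(T) → Hʲ(Z)((j−3)/2)` (`j` odd, `j ≤ n`) are accounted for by algebraic correspondences; `T × X` for a fourfold: `HC(T × X) ⟺ dim_ℚ Hom_HS(H³T, H¹X(−1)) ≤ dim_ℂ ⟨algebraic actions H⁷(X;ℂ) → H³(T;ℂ)⟩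
# ∧ dim_ℚ Hom_HS(H³T, H³X) ≤ dim_ℂ ⟨algebraic actions H⁵(X;ℂ) → H³(T;ℂ)⟩`; `HC(T × X)` outright when `b₁(X) = b₃(X) = 0`
# (Voisin I §11.3.3 Thm. 11.38–11.40, Lemma 11.41, p. 287, §6.2.3 Thm. 6.25, §11.3.1 Thm. 11.30; Voisin II (10.7), §11.1.1; Voisin 2025 §3.2.1; Deligne 2000 §1)

Family `hodge`, lane `lit-hodgefound` (Track 2 foundations library; Layers A1/A4), layer `Literature/AlgebraicGeometry/HodgeTheory`.  THEOREMS ONLY (no definition, no named fact, no instance;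
D-0026 net debt `0`).  Third instalment of the «off-middle algebraic factor» readings of the seat's g30-#3/#4 (curves: g30-#7; regular surfaces: g30-#8).  A smooth projective THREEFOLD `T` with
`q(T) = h^{1,0}(T) = 0` and `h^{2,0}(T) = 0` is off-middle algebraic in dimension `3`: `b₁(T) = b₅(T) = 0`, and ALL its even cohomology is of pure type (`H⁰`, `H² = H^{1,1}` by `h^{2,0} = 0`, `H⁴` by
duality, `H⁶`), while `HC(T)` is a theorem; `H³(T)` is arbitrary (for a Calabi–Yau threefold `h^{3,0} = 1`).  §2: for an `n`-fold `Z` with `HC(Z)` the pieces to decide are `H³(T) ⊗ Hʲ(Z) ⊂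
H^{3+j}(T × Z)`, `j` odd, `1 ≤ j ≤ n`, whose Hodge classes are the morphisms of Hodge structures `H³(T) → Hʲ(Z)((j − 3)/2)` (Lemma 11.41; for `j = 3` those underlying homomorphisms of the
intermediate Jacobians), and **`HC(T × Z)` iff each of them acts on `H^{2n−j}(Z;ℂ)` as some rational algebraic class of `H^{3+j}(T × Z)` does, iff `dim_ℚ Hom_HS(H³T, HʲZ((j−3)/2)) ≤ dim_ℂ ⟨algebraic
actions H^{2n−j}(Z;ℂ) → H³(T;ℂ)⟩` for each such `j`**.  §3 spells this out for a smooth projective FOURFOLD `X` with `HC(X)` (pieces `H³T ⊗ H¹X ⊂ H⁴`, `H³T ⊗ H³X ⊂ H⁶`), with the family form and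
the consequence **`HC(T × X)` for every such `T` and every fourfold `X` with `HC(X)` and `b₁(X) = b₃(X) = 0`** (no odd piece carries a Hodge class).  Two such threefolds `T × T'` are the seat's g30-#6
§4 (`…_of_q_zero_of_h20_zero…`) and are not restated; `T × S`, `T × C` are g30-#5 §3 and g30-#7 up to the swap.

WHAT IS PROVED.
* §1 **`BettiUniverse.finrank_bettiCohomology_eq_zero_threefold_of_q_zero_of_odd_of_ne_three`** (`b_k(T) = 0` for odd `k ≠ 3` when `q(T) = 0`).
* §2 (`T` with `q = h^{2,0} = 0`, `n`-fold `Z` with `HC(Z)`) **`BettiUniverse.hodgeConjectureFor_threefold_tensor_iff_forall_exists_corrAction_eq_of_q_zero_of_h20_zero`** (∃-form on the pieces `(3, j)`,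
  `j` odd, `1 ≤ j ≤ n`), **`…_iff_forall_finrank_le_of_q_zero_of_h20_zero`** (numeric form), **`…_iff_forall_finrank_hom_le_of_q_zero_of_h20_zero`** (Hom form), **`BettiUniverse.kunneth_piece_threefold_algebraic_iff_finrank_le_of_q_zero_of_h20_zero`**,
  **`BettiUniverse.kunneth_piece_threefold_algebraic_iff_exists_corrAction_eq_of_q_zero_of_h20_zero`** (one piece).
* §3 (fourfold `X` with `HC(X)`) **`BettiUniverse.hodgeConjectureFor_threefold_tensor_fourfold_iff_finrank_hom_le_finrank_span_of_q_zero_of_h20_zero`** (the two-piece criterion of the title),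
  **`…_iff_forall_exists_corrAction_eq_of_q_zero_of_h20_zero`** (∃-form), **`…_of_linearIndependent_corrAction`** (family form),
  **`BettiUniverse.hodgeConjectureFor_threefold_tensor_fourfold_of_q_zero_of_h20_zero_of_finrank_one_three_eq_zero`** (`b₁(X) = b₃(X) = 0` ⇒ `HC(T × X)`).

THE PRINTS.  C. Voisin (2002) [VoisinHodgeI2002] §6.2.3 Thm. 6.25; §7.1.2; §11.1.2 Prop. 11.20; §11.3.1 Thm. 11.30; §11.3.3 Thm. 11.38–11.40, Lemma 11.41 and pp. 286–287; §12.1.  C. Voisin (2003) [VoisinHodgeII2003]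
§10.2.2 proof of Thm. 10.17, (10.7); §11.1.1.  C. Voisin (2025) [Voisin2025] §3.2.1 (12)–(14), Prop. 3.8, Cor. 3.9.  P. Deligne (2000/2006) [Deligne2000] §1.  A. Hatcher (2002) [HatcherAT2002] §3.3 Thm. 3.26, Cor. 3.37.

THE OBJECTS (all the tree's).  `corrAction μ hY hZ hab`, `BettiUniverse.crossMap`, `BettiUniverse.kunnethSummand`, `BettiUniverse.hodge hHD hX k`, `hodgeNumber`, `hodgeClasses`, `HodgeStructure.Hom`, `tensor`,
`tateTwist`, `cast`, `bettiCohomology`, `complexBetti`, `ofRatClass`, `algebraicClasses`, `HodgeConjectureFor`; `hodgeConjectureFor_of_dim_le_three_holds` (`HC` in dimension `≤ 3`, tree theorem).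

DEVIATIONS / SCOPE.  `HC(Z)` (resp. `HC(X)`) is a hypothesis; which algebraic correspondences `T ⊢ Z` exist is the geometry of the pair and is not discussed.  Threefolds with `q > 0` or `h^{2,0} > 0`
are not off-middle algebraic and are not treated here (two arbitrary threefolds: the seat's g30-#6).  No definitions.

## References
* [VoisinHodgeI2002] C. Voisin, *Hodge Theory and Complex Algebraic Geometry I* (2002) — §6.2.3 Thm. 6.25; §7.1.2; §11.1.2 Prop. 11.20; §11.3.1 Thm. 11.30; §11.3.3 Thm. 11.38, Thm. 11.40, Lemma 11.41, pp. 286–287; §12.1.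
* [VoisinHodgeII2003] C. Voisin, *Hodge Theory and Complex Algebraic Geometry II* (2003) — §10.2.2 proof of Thm. 10.17 (10.7); §11.1.1.
* [Voisin2025] C. Voisin, *Cycle classes on algebraic varieties* (2025) — §3.2.1 (12)–(14), Prop. 3.8, Cor. 3.9.
* [Deligne2000] P. Deligne, *The Hodge conjecture* (Clay problem description) — §1.
* [HatcherAT2002] A. Hatcher, *Algebraic Topology* (2002) — §3.3 Thm. 3.26, Cor. 3.37.

## Provenance
Lane `lit-hodgefound` (Hodge path, Track 2), prover seat `lit-hodgefound-p29` (generation 30), self-proposed row g30-#10 (g30-#3/#4 LEFT read with `Y` a threefold without `H^{1,0}`, `H^{2,0}`).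
-/

noncomputable section

open scoped TensorProduct
open CategoryTheory MonoidalCategory CartesianMonoidalCategory Module Finset
open Literature.AlgebraicTopology.SingularHomology
open Literature.Geometry.Kaehler

namespace Literature.AlgebraicGeometry.HodgeTheory

open Literature.AlgebraicGeometry.Motives
open Literature.AlgebraicGeometry.Motives.HodgeStructure

variable {n d : ℕ} {T X Z : SchemeOver ℂ}

/-! ### §1 A threefold with `q = 0` has no odd cohomology off the middle degree -/

/-- **`b_k(T) = 0` for `k` odd, `k ≠ 3`, when `q(T) = h^{1,0}(T) = 0`** (`b₁ = 2q = 0`, `b₅ = b₁` by Poincaré duality, `Hᵏ = 0` for `k ≥ 7`), in the «off-middle» shape of the seat's g30-#3/#4.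
[cite: VoisinHodgeI2002, §6.2.3 Thm. 6.25, §7.1.2] [cite: HatcherAT2002, §3.3 Thm. 3.26 and Cor. 3.37] -/
theorem BettiUniverse.finrank_bettiCohomology_eq_zero_threefold_of_q_zero_of_odd_of_ne_three [HodgeTensorFacts.{0, 0}] (hHD : exists_isReal_hodgeModel) (hT : IsSmoothProjective 3 T)
    (h10 : (BettiUniverse.hodge hHD hT 1).hodgeNumber 1 0 = 0) (k : ℕ) (hk : Odd k) (hk3 : k ≠ 3) : Module.finrank ℚ (bettiCohomology T k) = 0 := by
  have h1 : Module.finrank ℚ (bettiCohomology T 1) = 0 := (BettiUniverse.finrank_bettiCohomology_one_eq_zero_iff hHD hT).2 h10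
  obtain ⟨r, rfl⟩ := hk
  rcases Nat.lt_or_ge r 3 with hr | hr
  · rcases (show r = 0 ∨ r = 2 by omega) with rfl | rfl
    · exact h1
    · rw [BettiUniverse.finrank_bettiCohomology_eq_of_add_eq hT (k := 2 * 2 + 1) (l := 1) (by norm_num)]
      exact h1
  · exact BettiUniverse.finrank_bettiCohomology_eq_zero_of_lt hT (by omega)

section Pieces

variable [HodgeTensorFacts.{0, 0}] (μ : OrientationFamily)

/-! ### §2 `HC(T × Z)` on the pieces `H³(T) ⊗ Hʲ(Z)`, `j` odd, `j ≤ dim Z` -/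

/-- **`HC(T × Z)` IFF every Hodge class of every piece `H³(T) ⊗ Hʲ(Z)`, `j` odd, `1 ≤ j ≤ n`, acts on `H^{2n−j}(Z;ℂ)` as some rational algebraic class of `H^{3+j}(T × Z)` does** (`T` a smooth projective
threefold with `q = h^{2,0} = 0`, `Z` an `n`-fold with `HC(Z)`; `3 + j = 2c` forces `j` odd; the Hodge classes of `H³(T) ⊗ Hʲ(Z)` are the morphisms of Hodge structures `H³(T) → Hʲ(Z)(c − 3)`, Lemma 11.41).
[cite: VoisinHodgeI2002, §11.3.3 Thm. 11.38–11.40, Lemma 11.41 and pp. 286–287, §11.3.1 Thm. 11.30] [cite: VoisinHodgeII2003, §11.1.1] [cite: Voisin2025, §3.2.1 (12)–(14), Prop. 3.8 and Cor. 3.9] [cite: Deligne2000, §1] -/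
theorem BettiUniverse.hodgeConjectureFor_threefold_tensor_iff_forall_exists_corrAction_eq_of_q_zero_of_h20_zero (hHD : exists_isReal_hodgeModel) (hT : IsSmoothProjective 3 T)
    (hZ : IsSmoothProjective n Z) (hTZ : IsSmoothProjective d (T ⊗ Z)) (hHCZ : HodgeConjectureFor n Z) (h10 : (BettiUniverse.hodge hHD hT 1).hodgeNumber 1 0 = 0)
    (h20 : (BettiUniverse.hodge hHD hT 2).hodgeNumber 2 0 = 0) :
    HodgeConjectureFor d (T ⊗ Z) ↔
      ∀ (c j a : ℕ) (hj : 3 + j = 2 * c) (hab : a + 2 * c = 3 + 2 * n), 1 ≤ j → j ≤ n →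
        ∀ t ∈ (BettiUniverse.kunnethSummand hHD hT hZ (2 * c) ⟨(3, j), HasAntidiagonal.mem_antidiagonal.2 hj⟩).hodgeClasses c,
          ∃ γ : bettiCohomology (T ⊗ Z) (2 * c), ofRatClass (ComplexPoints (T ⊗ Z)) (2 * c) γ ∈ algebraicClasses (T ⊗ Z) c ∧
            corrAction μ hT hZ hab (ofRatClass (ComplexPoints (T ⊗ Z)) (2 * c) γ) = corrAction μ hT hZ hab (ofRatClass (ComplexPoints (T ⊗ Z)) (2 * c) (BettiUniverse.crossMap T Z hj t)) :=
  BettiUniverse.hodgeConjectureFor_tensor_iff_forall_exists_corrAction_eq_left μ hHD hT hZ hTZ (hodgeConjectureFor_of_dim_le_three_holds le_rfl hT) hHCZ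
    (BettiUniverse.finrank_bettiCohomology_eq_zero_threefold_of_q_zero_of_odd_of_ne_three hHD hT h10) (fun b _ ↦ BettiUniverse.hodgeClasses_hodge_eq_top_threefold_of_h20_zero hHD hT h20 b)

/-- **NUMERIC FORM: `HC(T × Z) ⟺` for every odd `j` with `1 ≤ j ≤ n`: `dim_ℚ Hdgᶜ(H³T ⊗ HʲZ) ≤ dim_ℂ ⟨actions on H^{2n−j}(Z;ℂ) of the rational algebraic classes of H^{3+j}(T × Z)⟩`** (`2c = 3 + j`).
[cite: VoisinHodgeI2002, §11.3.3 Thm. 11.38–11.40, Lemma 11.41 and pp. 286–287] [cite: Voisin2025, §3.2.1 (12)–(14), Prop. 3.8 and Cor. 3.9] [cite: Deligne2000, §1] -/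
theorem BettiUniverse.hodgeConjectureFor_threefold_tensor_iff_forall_finrank_le_of_q_zero_of_h20_zero (hHD : exists_isReal_hodgeModel) (hT : IsSmoothProjective 3 T)
    (hZ : IsSmoothProjective n Z) (hTZ : IsSmoothProjective d (T ⊗ Z)) (hHCZ : HodgeConjectureFor n Z) (h10 : (BettiUniverse.hodge hHD hT 1).hodgeNumber 1 0 = 0)
    (h20 : (BettiUniverse.hodge hHD hT 2).hodgeNumber 2 0 = 0) :
    HodgeConjectureFor d (T ⊗ Z) ↔
      ∀ (c j a : ℕ) (_hj : 3 + j = 2 * c) (hab : a + 2 * c = 3 + 2 * n), 1 ≤ j → j ≤ n →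
        Module.finrank ℚ ↥(((BettiUniverse.hodge hHD hT 3).tensor (BettiUniverse.hodge hHD hZ j)).hodgeClasses c) ≤
          Module.finrank ℂ ↥(Submodule.span ℂ ((fun γ ↦ corrAction μ hT hZ hab (ofRatClass (ComplexPoints (T ⊗ Z)) (2 * c) γ)) ''
            {γ : bettiCohomology (T ⊗ Z) (2 * c) | ofRatClass (ComplexPoints (T ⊗ Z)) (2 * c) γ ∈ algebraicClasses (T ⊗ Z) c})) :=
  BettiUniverse.hodgeConjectureFor_tensor_iff_forall_finrank_le_left μ hHD hT hZ hTZ (hodgeConjectureFor_of_dim_le_three_holds le_rfl hT) hHCZ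
    (BettiUniverse.finrank_bettiCohomology_eq_zero_threefold_of_q_zero_of_odd_of_ne_three hHD hT h10) (fun b _ ↦ BettiUniverse.hodgeClasses_hodge_eq_top_threefold_of_h20_zero hHD hT h20 b)

/-- **HOM FORM: `HC(T × Z) ⟺` for every odd `j` with `1 ≤ j ≤ n`: `dim_ℚ Hom_HS(H³(T), Hʲ(Z)(c − 3)) ≤ dim_ℂ ⟨actions on H^{2n−j}(Z;ℂ) of the rational algebraic classes of H^{3+j}(T × Z)⟩`** (`2c = 3 + j`).
[cite: VoisinHodgeI2002, §11.3.3 Thm. 11.38–11.40, Lemma 11.41 and pp. 286–287] [cite: Voisin2025, §3.2.1 (12)–(14), Prop. 3.8 and Cor. 3.9] [cite: Deligne2000, §1] -/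
theorem BettiUniverse.hodgeConjectureFor_threefold_tensor_iff_forall_finrank_hom_le_of_q_zero_of_h20_zero (hHD : exists_isReal_hodgeModel) (hT : IsSmoothProjective 3 T)
    (hZ : IsSmoothProjective n Z) (hTZ : IsSmoothProjective d (T ⊗ Z)) (hHCZ : HodgeConjectureFor n Z) (h10 : (BettiUniverse.hodge hHD hT 1).hodgeNumber 1 0 = 0)
    (h20 : (BettiUniverse.hodge hHD hT 2).hodgeNumber 2 0 = 0) :
    HodgeConjectureFor d (T ⊗ Z) ↔
      ∀ (c j a : ℕ) (hj : 3 + j = 2 * c) (hab : a + 2 * c = 3 + 2 * n), 1 ≤ j → j ≤ n →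
        Module.finrank ℚ (HodgeStructure.Hom (BettiUniverse.hodge hHD hT 3) (((BettiUniverse.hodge hHD hZ j).tateTwist ((c : ℤ) - 3)).cast (by omega))) ≤
          Module.finrank ℂ ↥(Submodule.span ℂ ((fun γ ↦ corrAction μ hT hZ hab (ofRatClass (ComplexPoints (T ⊗ Z)) (2 * c) γ)) ''
            {γ : bettiCohomology (T ⊗ Z) (2 * c) | ofRatClass (ComplexPoints (T ⊗ Z)) (2 * c) γ ∈ algebraicClasses (T ⊗ Z) c})) := by
  rw [BettiUniverse.hodgeConjectureFor_threefold_tensor_iff_forall_finrank_le_of_q_zero_of_h20_zero μ hHD hT hZ hTZ hHCZ h10 h20]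
  refine forall_congr' fun c ↦ forall_congr' fun j ↦ forall_congr' fun a ↦ forall_congr' fun hj ↦ forall_congr' fun hab ↦ forall_congr' fun _ ↦ forall_congr' fun _ ↦ ?_
  have e := BettiUniverse.finrank_hodgeClasses_tensor_hodge_eq_finrank_hom_tateTwist hHD hT hZ 3 j (s := (c : ℤ) - 3) (by omega)
  rw [show (((3 : ℕ) : ℤ) + ((c : ℤ) - 3)) = ((c : ℕ) : ℤ) by ring] at e
  rw [e]

/-- **One piece, numeric form** (`T` with `q = h^{2,0} = 0`, `Z` with `HC(Z)`): the piece `H³(T) ⊗ Hʲ(Z)` of `H^{2c}(T × Z)` is algebraic iff `dim_ℚ Hdgᶜ(H³T ⊗ HʲZ) ≤ dim_ℂ ⟨actions on H^{2n−j}(Z;ℂ) of the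
rational algebraic classes of H^{2c}(T × Z)⟩`. [cite: VoisinHodgeI2002, §11.3.3 Thm. 11.38–11.40, Lemma 11.41 and pp. 286–287] [cite: Voisin2025, §3.2.1 (12)–(14), Prop. 3.8 and Cor. 3.9] -/
theorem BettiUniverse.kunneth_piece_threefold_algebraic_iff_finrank_le_of_q_zero_of_h20_zero (hHD : exists_isReal_hodgeModel) (hT : IsSmoothProjective 3 T) (hZ : IsSmoothProjective n Z)
    (hHCZ : HodgeConjectureFor n Z) (h10 : (BettiUniverse.hodge hHD hT 1).hodgeNumber 1 0 = 0) (h20 : (BettiUniverse.hodge hHD hT 2).hodgeNumber 2 0 = 0) {c j a : ℕ} (hj : 3 + j = 2 * c)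
    (haj : a + j = 2 * n) (hab : a + 2 * c = 3 + 2 * n) :
    (∀ t ∈ (BettiUniverse.kunnethSummand hHD hT hZ (2 * c) ⟨(3, j), HasAntidiagonal.mem_antidiagonal.2 hj⟩).hodgeClasses c,
        ofRatClass (ComplexPoints (T ⊗ Z)) (2 * c) (BettiUniverse.crossMap T Z hj t) ∈ algebraicClasses (T ⊗ Z) c) ↔
      Module.finrank ℚ ↥(((BettiUniverse.hodge hHD hT 3).tensor (BettiUniverse.hodge hHD hZ j)).hodgeClasses c) ≤
        Module.finrank ℂ ↥(Submodule.span ℂ ((fun γ ↦ corrAction μ hT hZ hab (ofRatClass (ComplexPoints (T ⊗ Z)) (2 * c) γ)) ''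
          {γ : bettiCohomology (T ⊗ Z) (2 * c) | ofRatClass (ComplexPoints (T ⊗ Z)) (2 * c) γ ∈ algebraicClasses (T ⊗ Z) c})) :=
  BettiUniverse.kunneth_piece_algebraic_iff_finrank_le_left μ hHD hT hZ (hodgeConjectureFor_of_dim_le_three_holds le_rfl hT) hHCZ
    (BettiUniverse.finrank_bettiCohomology_eq_zero_threefold_of_q_zero_of_odd_of_ne_three hHD hT h10) (fun b _ ↦ BettiUniverse.hodgeClasses_hodge_eq_top_threefold_of_h20_zero hHD hT h20 b)
    hj haj hab

/-- **One piece, ∃-form** (`T` with `q = h^{2,0} = 0`, `Z` with `HC(Z)`): the piece `H³(T) ⊗ Hʲ(Z)` of `H^{2c}(T × Z)` is algebraic iff each of its Hodge classes acts on `H^{2n−j}(Z;ℂ)` as some rational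
algebraic class of `H^{2c}(T × Z)` does. [cite: VoisinHodgeI2002, §11.1.2 Prop. 11.20, §11.3.3 Thm. 11.38–11.40, Lemma 11.41 and pp. 286–287] [cite: Voisin2025, §3.2.1 (12)–(14), Prop. 3.8 and Cor. 3.9] -/
theorem BettiUniverse.kunneth_piece_threefold_algebraic_iff_exists_corrAction_eq_of_q_zero_of_h20_zero (hHD : exists_isReal_hodgeModel) (hT : IsSmoothProjective 3 T)
    (hZ : IsSmoothProjective n Z) (hHCZ : HodgeConjectureFor n Z) (h10 : (BettiUniverse.hodge hHD hT 1).hodgeNumber 1 0 = 0) (h20 : (BettiUniverse.hodge hHD hT 2).hodgeNumber 2 0 = 0)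
    {c j a : ℕ} (hj : 3 + j = 2 * c) (haj : a + j = 2 * n) (hab : a + 2 * c = 3 + 2 * n) :
    (∀ t ∈ (BettiUniverse.kunnethSummand hHD hT hZ (2 * c) ⟨(3, j), HasAntidiagonal.mem_antidiagonal.2 hj⟩).hodgeClasses c,
        ofRatClass (ComplexPoints (T ⊗ Z)) (2 * c) (BettiUniverse.crossMap T Z hj t) ∈ algebraicClasses (T ⊗ Z) c) ↔
      ∀ t ∈ (BettiUniverse.kunnethSummand hHD hT hZ (2 * c) ⟨(3, j), HasAntidiagonal.mem_antidiagonal.2 hj⟩).hodgeClasses c,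
        ∃ γ : bettiCohomology (T ⊗ Z) (2 * c), ofRatClass (ComplexPoints (T ⊗ Z)) (2 * c) γ ∈ algebraicClasses (T ⊗ Z) c ∧
          corrAction μ hT hZ hab (ofRatClass (ComplexPoints (T ⊗ Z)) (2 * c) γ) = corrAction μ hT hZ hab (ofRatClass (ComplexPoints (T ⊗ Z)) (2 * c) (BettiUniverse.crossMap T Z hj t)) := by
  refine ⟨fun h t ht ↦ ⟨_, h t ht, rfl⟩, fun h t ht ↦ ?_⟩
  obtain ⟨γ, hγ, hact⟩ := h t ht
  exact BettiUniverse.ofRatClass_crossMap_mem_algebraicClasses_of_corrAction_eq_left μ hHD hT hZ (hodgeConjectureFor_of_dim_le_three_holds le_rfl hT) hHCZ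
    (BettiUniverse.finrank_bettiCohomology_eq_zero_threefold_of_q_zero_of_odd_of_ne_three hHD hT h10) (fun b _ ↦ BettiUniverse.hodgeClasses_hodge_eq_top_threefold_of_h20_zero hHD hT h20 b)
    hj haj hab hγ hact

/-! ### §3 Such a threefold times a fourfold -/

/-- **`T × X` for a threefold `T` with `q = h^{2,0} = 0` and a smooth projective FOURFOLD `X` with `HC(X)`: `HC(T × X) ⟺ [dim_ℚ Hom_HS(H³T, H¹X(−1)) ≤ dim_ℂ ⟨actions H⁷(X;ℂ) → H³(T;ℂ) of the rational
algebraic classes of H⁴(T × X)⟩] ∧ [dim_ℚ Hom_HS(H³T, H³X) ≤ dim_ℂ ⟨actions H⁵(X;ℂ) → H³(T;ℂ) of the rational algebraic classes of H⁶(T × X)⟩]`** (the odd `j ≤ 4` are `1` and `3`).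
[cite: VoisinHodgeI2002, §11.3.3 Thm. 11.38–11.40, Lemma 11.41 and pp. 286–287] [cite: Voisin2025, §3.2.1 (12)–(14), Prop. 3.8 and Cor. 3.9] [cite: Deligne2000, §1] -/
theorem BettiUniverse.hodgeConjectureFor_threefold_tensor_fourfold_iff_finrank_hom_le_finrank_span_of_q_zero_of_h20_zero (hHD : exists_isReal_hodgeModel) (hT : IsSmoothProjective 3 T)
    (hX : IsSmoothProjective 4 X) (hTX : IsSmoothProjective d (T ⊗ X)) (hHCX : HodgeConjectureFor 4 X) (h10 : (BettiUniverse.hodge hHD hT 1).hodgeNumber 1 0 = 0)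
    (h20 : (BettiUniverse.hodge hHD hT 2).hodgeNumber 2 0 = 0) :
    HodgeConjectureFor d (T ⊗ X) ↔
      Module.finrank ℚ (HodgeStructure.Hom (BettiUniverse.hodge hHD hT 3) (((BettiUniverse.hodge hHD hX 1).tateTwist (-1)).cast (by norm_num))) ≤
          Module.finrank ℂ ↥(Submodule.span ℂ ((fun γ ↦ corrAction μ hT hX (rfl : 7 + 2 * 2 = 3 + 2 * 4) (ofRatClass (ComplexPoints (T ⊗ X)) (2 * 2) γ)) ''
            {γ : bettiCohomology (T ⊗ X) (2 * 2) | ofRatClass (ComplexPoints (T ⊗ X)) (2 * 2) γ ∈ algebraicClasses (T ⊗ X) 2})) ∧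
        Module.finrank ℚ (HodgeStructure.Hom (BettiUniverse.hodge hHD hT 3) (BettiUniverse.hodge hHD hX 3)) ≤
          Module.finrank ℂ ↥(Submodule.span ℂ ((fun γ ↦ corrAction μ hT hX (rfl : 5 + 2 * 3 = 3 + 2 * 4) (ofRatClass (ComplexPoints (T ⊗ X)) (2 * 3) γ)) ''
            {γ : bettiCohomology (T ⊗ X) (2 * 3) | ofRatClass (ComplexPoints (T ⊗ X)) (2 * 3) γ ∈ algebraicClasses (T ⊗ X) 3})) := by
  have e₁ := BettiUniverse.finrank_hodgeClasses_tensor_hodge_eq_finrank_hom_tateTwist hHD hT hX 3 1 (s := -1) (by norm_num)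
  rw [show (((3 : ℕ) : ℤ) + (-1)) = ((2 : ℕ) : ℤ) by norm_num] at e₁
  have e₃ := BettiUniverse.finrank_hodgeClasses_tensor_hodge_eq_finrank_hom hHD hT hX 3
  rw [← e₁, ← e₃, BettiUniverse.hodgeConjectureFor_threefold_tensor_iff_forall_finrank_le_of_q_zero_of_h20_zero μ hHD hT hX hTX hHCX h10 h20]
  refine ⟨fun h ↦ ⟨h 2 1 7 (by norm_num) rfl le_rfl (by norm_num), h 3 3 5 (by norm_num) rfl (by norm_num) (by norm_num)⟩, fun h c j a hj hab hj1 hjn ↦ ?_⟩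
  rcases (show j = 1 ∨ j = 2 ∨ j = 3 ∨ j = 4 by omega) with rfl | rfl | rfl | rfl
  · obtain rfl : c = 2 := by omega
    obtain rfl : a = 7 := by omega
    exact h.1
  · exfalso
    omega
  · obtain rfl : c = 3 := by omega
    obtain rfl : a = 5 := by omega
    exact h.2
  · exfalso
    omega

/-- **∃-form for `T × X`** (`T` with `q = h^{2,0} = 0`, `X` a fourfold with `HC(X)`): `HC(T × X)` iff every Hodge class of `H³(T) ⊗ H¹(X)` acts on `H⁷(X;ℂ)`, and every Hodge class of `H³(T) ⊗ H³(X)`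
acts on `H⁵(X;ℂ)`, as some rational algebraic class of `H⁴(T × X)`, resp. `H⁶(T × X)`, does. [cite: VoisinHodgeI2002, §11.3.3 Thm. 11.38–11.40, Lemma 11.41 and pp. 286–287] [cite: Voisin2025, §3.2.1 (12)–(14), Prop. 3.8 and Cor. 3.9]
[cite: Deligne2000, §1] -/
theorem BettiUniverse.hodgeConjectureFor_threefold_tensor_fourfold_iff_forall_exists_corrAction_eq_of_q_zero_of_h20_zero (hHD : exists_isReal_hodgeModel) (hT : IsSmoothProjective 3 T)
    (hX : IsSmoothProjective 4 X) (hTX : IsSmoothProjective d (T ⊗ X)) (hHCX : HodgeConjectureFor 4 X) (h10 : (BettiUniverse.hodge hHD hT 1).hodgeNumber 1 0 = 0)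
    (h20 : (BettiUniverse.hodge hHD hT 2).hodgeNumber 2 0 = 0) :
    HodgeConjectureFor d (T ⊗ X) ↔
      (∀ t ∈ (BettiUniverse.kunnethSummand hHD hT hX (2 * 2) ⟨(3, 1), HasAntidiagonal.mem_antidiagonal.2 rfl⟩).hodgeClasses 2,
        ∃ γ : bettiCohomology (T ⊗ X) (2 * 2), ofRatClass (ComplexPoints (T ⊗ X)) (2 * 2) γ ∈ algebraicClasses (T ⊗ X) 2 ∧
          corrAction μ hT hX (rfl : 7 + 2 * 2 = 3 + 2 * 4) (ofRatClass (ComplexPoints (T ⊗ X)) (2 * 2) γ) =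
            corrAction μ hT hX (rfl : 7 + 2 * 2 = 3 + 2 * 4) (ofRatClass (ComplexPoints (T ⊗ X)) (2 * 2) (BettiUniverse.crossMap T X (show 3 + 1 = 2 * 2 by norm_num) t))) ∧
      (∀ t ∈ (BettiUniverse.kunnethSummand hHD hT hX (2 * 3) ⟨(3, 3), HasAntidiagonal.mem_antidiagonal.2 rfl⟩).hodgeClasses 3,
        ∃ γ : bettiCohomology (T ⊗ X) (2 * 3), ofRatClass (ComplexPoints (T ⊗ X)) (2 * 3) γ ∈ algebraicClasses (T ⊗ X) 3 ∧
          corrAction μ hT hX (rfl : 5 + 2 * 3 = 3 + 2 * 4) (ofRatClass (ComplexPoints (T ⊗ X)) (2 * 3) γ) =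
            corrAction μ hT hX (rfl : 5 + 2 * 3 = 3 + 2 * 4) (ofRatClass (ComplexPoints (T ⊗ X)) (2 * 3) (BettiUniverse.crossMap T X (show 3 + 3 = 2 * 3 by norm_num) t))) := by
  rw [BettiUniverse.hodgeConjectureFor_threefold_tensor_iff_forall_exists_corrAction_eq_of_q_zero_of_h20_zero μ hHD hT hX hTX hHCX h10 h20]
  refine ⟨fun h ↦ ⟨fun t ht ↦ h 2 1 7 (by norm_num) rfl le_rfl (by norm_num) t ht, fun t ht ↦ h 3 3 5 (by norm_num) rfl (by norm_num) (by norm_num) t ht⟩,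
    fun h c j a hj hab hj1 hjn t ht ↦ ?_⟩
  rcases (show j = 1 ∨ j = 2 ∨ j = 3 ∨ j = 4 by omega) with rfl | rfl | rfl | rfl
  · obtain rfl : c = 2 := by omega
    obtain rfl : a = 7 := by omega
    exact h.1 t ht
  · exfalso
    omega
  · obtain rfl : c = 3 := by omega
    obtain rfl : a = 5 := by omega
    exact h.2 t ht
  · exfalso
    omega

/-- **Family form for `T × X`** (`T` with `q = h^{2,0} = 0`, `X` a fourfold with `HC(X)`): `|ι|` rational algebraic classes of `H⁴(T × X)` with ℂ-linearly independent actions `H⁷(X;ℂ) → H³(T;ℂ)`,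
`|κ|` rational algebraic classes of `H⁶(T × X)` with ℂ-linearly independent actions `H⁵(X;ℂ) → H³(T;ℂ)`, `dim_ℚ Hom_HS(H³T, H¹X(−1)) ≤ |ι|` and `dim_ℚ Hom_HS(H³T, H³X) ≤ |κ|` ⇒ `HC(T × X)`.
[cite: VoisinHodgeI2002, §11.3.3 Thm. 11.38–11.40, Lemma 11.41 and pp. 286–287] [cite: Voisin2025, §3.2.1 (12)–(14), Prop. 3.8 and Cor. 3.9] [cite: Deligne2000, §1] -/
theorem BettiUniverse.hodgeConjectureFor_threefold_tensor_fourfold_of_linearIndependent_corrAction {ι κ : Type} [Fintype ι] [Fintype κ] (hHD : exists_isReal_hodgeModel)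
    (hT : IsSmoothProjective 3 T) (hX : IsSmoothProjective 4 X) (hTX : IsSmoothProjective d (T ⊗ X)) (hHCX : HodgeConjectureFor 4 X) (h10 : (BettiUniverse.hodge hHD hT 1).hodgeNumber 1 0 = 0)
    (h20 : (BettiUniverse.hodge hHD hT 2).hodgeNumber 2 0 = 0)
    (γ : ι → bettiCohomology (T ⊗ X) (2 * 2)) (hγ : ∀ k, ofRatClass (ComplexPoints (T ⊗ X)) (2 * 2) (γ k) ∈ algebraicClasses (T ⊗ X) 2)
    (hind : LinearIndependent ℂ fun k ↦ corrAction μ hT hX (rfl : 7 + 2 * 2 = 3 + 2 * 4) (ofRatClass (ComplexPoints (T ⊗ X)) (2 * 2) (γ k)))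
    (hHom : Module.finrank ℚ (HodgeStructure.Hom (BettiUniverse.hodge hHD hT 3) (((BettiUniverse.hodge hHD hX 1).tateTwist (-1)).cast (by norm_num))) ≤ Fintype.card ι)
    (δ : κ → bettiCohomology (T ⊗ X) (2 * 3)) (hδ : ∀ k, ofRatClass (ComplexPoints (T ⊗ X)) (2 * 3) (δ k) ∈ algebraicClasses (T ⊗ X) 3)
    (hind' : LinearIndependent ℂ fun k ↦ corrAction μ hT hX (rfl : 5 + 2 * 3 = 3 + 2 * 4) (ofRatClass (ComplexPoints (T ⊗ X)) (2 * 3) (δ k)))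
    (hHom' : Module.finrank ℚ (HodgeStructure.Hom (BettiUniverse.hodge hHD hT 3) (BettiUniverse.hodge hHD hX 3)) ≤ Fintype.card κ) : HodgeConjectureFor d (T ⊗ X) := by
  haveI := finite_complexBetti hX 7
  haveI := finite_complexBetti hX 5
  haveI := finite_complexBetti hT 3
  refine (BettiUniverse.hodgeConjectureFor_threefold_tensor_fourfold_iff_finrank_hom_le_finrank_span_of_q_zero_of_h20_zero μ hHD hT hX hTX hHCX h10 h20).2 ⟨hHom.trans ?_, hHom'.trans ?_⟩
  · have hsub : Submodule.span ℂ (Set.range fun k ↦ corrAction μ hT hX (rfl : 7 + 2 * 2 = 3 + 2 * 4) (ofRatClass (ComplexPoints (T ⊗ X)) (2 * 2) (γ k))) ≤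
        Submodule.span ℂ ((fun γ ↦ corrAction μ hT hX (rfl : 7 + 2 * 2 = 3 + 2 * 4) (ofRatClass (ComplexPoints (T ⊗ X)) (2 * 2) γ)) ''
          {γ : bettiCohomology (T ⊗ X) (2 * 2) | ofRatClass (ComplexPoints (T ⊗ X)) (2 * 2) γ ∈ algebraicClasses (T ⊗ X) 2}) :=
      Submodule.span_mono (Set.range_subset_iff.2 fun k ↦ ⟨γ k, hγ k, rfl⟩)
    refine le_trans ?_ (Submodule.finrank_mono hsub)
    rw [finrank_span_eq_card hind]
  · have hsub : Submodule.span ℂ (Set.range fun k ↦ corrAction μ hT hX (rfl : 5 + 2 * 3 = 3 + 2 * 4) (ofRatClass (ComplexPoints (T ⊗ X)) (2 * 3) (δ k))) ≤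
        Submodule.span ℂ ((fun γ ↦ corrAction μ hT hX (rfl : 5 + 2 * 3 = 3 + 2 * 4) (ofRatClass (ComplexPoints (T ⊗ X)) (2 * 3) γ)) ''
          {γ : bettiCohomology (T ⊗ X) (2 * 3) | ofRatClass (ComplexPoints (T ⊗ X)) (2 * 3) γ ∈ algebraicClasses (T ⊗ X) 3}) :=
      Submodule.span_mono (Set.range_subset_iff.2 fun k ↦ ⟨δ k, hδ k, rfl⟩)
    refine le_trans ?_ (Submodule.finrank_mono hsub)
    rw [finrank_span_eq_card hind']

/-- **`HC(T × X)` for a threefold `T` with `q(T) = h^{2,0}(T) = 0` and a fourfold `X` with `HC(X)` and `b₁(X) = b₃(X) = 0`**: the two odd pieces `H³(T) ⊗ H¹(X)`, `H³(T) ⊗ H³(X)` vanish, so no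
correspondence is needed (e.g. a Calabi–Yau or Fano threefold times a fourfold with vanishing odd Betti numbers that satisfies `HC`). [cite: VoisinHodgeI2002, §11.3.3 Thm. 11.38–11.40 and pp. 286–287]
[cite: Voisin2025, §3.2.1 (12)–(14), Prop. 3.8 and Cor. 3.9] [cite: Deligne2000, §1] -/
theorem BettiUniverse.hodgeConjectureFor_threefold_tensor_fourfold_of_q_zero_of_h20_zero_of_finrank_one_three_eq_zero (hHD : exists_isReal_hodgeModel) (hT : IsSmoothProjective 3 T)
    (hX : IsSmoothProjective 4 X) (hTX : IsSmoothProjective d (T ⊗ X)) (hHCX : HodgeConjectureFor 4 X) (h10 : (BettiUniverse.hodge hHD hT 1).hodgeNumber 1 0 = 0)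
    (h20 : (BettiUniverse.hodge hHD hT 2).hodgeNumber 2 0 = 0) (hb1 : Module.finrank ℚ (bettiCohomology X 1) = 0) (hb3 : Module.finrank ℚ (bettiCohomology X 3) = 0) :
    HodgeConjectureFor d (T ⊗ X) := by
  haveI := BettiUniverse.finite hT 3
  haveI := BettiUniverse.finite hX 1
  haveI := BettiUniverse.finite hX 3
  refine (BettiUniverse.hodgeConjectureFor_threefold_tensor_iff_forall_finrank_le_of_q_zero_of_h20_zero complexOrientationFamily hHD hT hX hTX hHCX h10 h20).2
    fun c j a hj hab hj1 hjn ↦ le_trans ?_ (Nat.zero_le _)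
  -- `j ∈ {1, 3}`: the carrier `H³(T;ℚ) ⊗ Hʲ(X;ℚ)` is already `0`
  have hbj : Module.finrank ℚ (bettiCohomology X j) = 0 := by
    rcases (show j = 1 ∨ j = 2 ∨ j = 3 ∨ j = 4 by omega) with rfl | rfl | rfl | rfl
    · exact hb1
    · exfalso; omega
    · exact hb3
    · exfalso; omega
  haveI := BettiUniverse.finite hX j
  refine (Submodule.finrank_le _).trans ?_
  rw [Module.finrank_tensorProduct, hbj, mul_zero]

end Pieces

end Literature.AlgebraicGeometry.HodgeTheory

end
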